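/-
Copyright (c) 2026. All rights reserved.
Released under Apache 2.0 license as described in the file LICENSE.
Authors: abc-iut cell, fact-proving seat abc-iut-f-102 (block F, tranche 102, gen 2).
-/
import Mathlib.Algebra.Category.Grp.Preadditive
import Mathlib.CategoryTheory.Preadditive.FunctorCategory
import Literature.AnabelianGeometry.AbsoluteAnabelian.LogFrobeniusShiftActionIotaIso
import Literature.AnabelianGeometry.AbsoluteAnabelian.LogFrobeniusShiftActionOfRealises
import HarnessLib

/-!
# [AbsTopIII] Corollary 5.5 (iii)/(v): a CROSS-PLACE obstruction to realising the cores and observables in one family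

S. Mochizuki, *Topics in absolute anabelian geometry III: global reconstruction algorithms*,
J. Math. Sci. Univ. Tokyo 22 (2015) 939–1156 [MochizukiAbsTopIII2015]; locators `p.N` = pages of the
author's manuscript (`paper:url-5493eb38cbb7`): Def 3.5 (ii), (iii) pp. 75–76, Def 5.4 (v), (vii) pp. 127–128 (the
archimedean graph `k~ →(id) k~ ↠ k^× ↪ k`, the `ι⊞_{v,ε}`), Cor 5.5 (i) p. 130, (iii) p. 131, (v) pp. 131–133.

Companion of this seat's THEOREM A (`LogFrobeniusShiftActionOfRealises.lean`: F-0157 ⟺ `∃ K`, F-0159) and of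
`LogFrobeniusShiftActionIotaIso.lean` (NECESSARY for F-0159: every pre-log `ι⊞_{v,ε}` invertible over `ℰ•`).  That condition
is PER PLACE; this file shows it is NOT sufficient, by exhibiting a constraint ACROSS places.  A CALIBRATION setting
(`CrossPlaceToy.setting`, DEGENERATE — no arithmetic content): index set `{true, false}`, both places archimedean, every category
one preadditive category `C`, every structure functor `𝟭`, every 2-cell an identity, and EVERY `ι⊞_{v,ε}` AN ISOMORPHISM: `+id`,
except the post-log arrow `k~ →(id) k~` at the place `true`, where `ι⊞ := −id` (`CrossPlaceToy.twist`).  Results: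
* `CrossPlaceToy.isIso_iota`: every `ι⊞_{v,ε}` of the setting is invertible (so every per-place necessary condition holds);
* `CrossPlaceToy.not_realisesCor55Families`: if `−𝟙_{x₀} ≠ 𝟙_{x₀}` for some object `x₀` of `C`, NO family of homotopies
  on `D•⊢` realises the cores of Cor 5.5 (i) and the observables of (iii) (`RealisesCor55Families`, F-0159) — inside such
  a family `K` the core `ℰ•` relates the `log`-first path `𝒳_1 → 𝒳_0 → □ →(λ_sl) 𝒩⊞_{true} → 𝒩_{true} → ℰ•` to the
  `id`-first path `𝒳_1 → □ →(λ_sl) ⋯ → ℰ•` by ONE homotopy (Def 3.5 (iii)); along the place `true` (post-log `ι = −1`,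
  then the pre-log chain `k~ ↠ k^× ↪ k` of `S_log⊞_{true}`: `+1, +1`) it is `−1`; through the place `false` (the `□`-level
  core isomorphism `α` between the two `λ_sl`-paths, the untwisted chain at `false`, and `α⁻¹`) it is `α ∘ 1 ∘ α⁻¹ = +1`;
* `exists_forall_not_realises_of_isIso_iota`: hence on abelian groups (`−1 ≠ 1` in `ℤ`) F-0159, and with it (THEOREM A /
  `cor55ShiftAction_iff`) `Cor55ShiftAction` (F-0157) and `Cor55Rigidity` (F-0156), FAIL at a setting all of whose `ι⊞` are
  isomorphisms.  In general the archimedean "post-log ∘ shell ∘ link" composites over `ℰ•` must be simultaneously CONJUGATE —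
  a cross-place coherence which print has from "lies over `Th•[Z]`" (Def 5.4 (iv)) and which the interface does not record.
A statement about the typed interface only; refereed pre-IUT material; nothing here bears on [IUTchIII] Cor. 3.12; no side
taken; typed ≠ proved.
-/

set_option autoImplicit false

universe u

open CategoryTheory Quiver

namespace Literature.AnabelianGeometry.AbsoluteAnabelian

namespace LogFrobeniusSetting

open DiagramOfCategories

namespace CrossPlaceToy

/-! ## The paths of `Γ⃗_{D•⊢}` in play (index set `ULift Bool`, both places archimedean) -/

/-- the tail `𝒩⊞_v → 𝒩_v → ℰ•`. [cite: MochizukiAbsTopIII2015, Cor 5.5 p. 129] -/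
def tail (v : ULift.{u} Bool) : Path (DVertex.nplus v : DVertex (ULift.{u} Bool) (fun _ => true)) .e5 :=
  (Path.nil.cons (DEdge.forget v : (DVertex.nplus v : DVertex (ULift.{u} Bool) (fun _ => true)) ⟶ .nv v)).cons
    (DEdge.toE v : (DVertex.nv v : DVertex (ULift.{u} Bool) (fun _ => true)) ⟶ .e5)

/-- `□ →(λ⊞_{v,ν}) 𝒩⊞_v → 𝒩_v → ℰ•`. [cite: MochizukiAbsTopIII2015, Cor 5.5 p. 129] -/
def fromCore (v : ULift.{u} Bool) (ν : LogVertex true) (hν : ν.isPostLog = false) :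
    Path (DVertex.core : DVertex (ULift.{u} Bool) (fun _ => true)) .e5 :=
  (Path.nil.cons (DEdge.lam v ν hν : (DVertex.core : DVertex (ULift.{u} Bool) (fun _ => true)) ⟶ .nplus v)).comp (tail v)

/-- `id_1 : 𝒳_1 → □`. [cite: MochizukiAbsTopIII2015, Cor 5.5 p. 129] -/
def idPrefix : Path (DVertex.row1 (0 + 1) : DVertex (ULift.{u} Bool) (fun _ => true)) .core :=
  Path.nil.cons (DEdge.toCore (0 + 1) : (DVertex.row1 (0 + 1) : DVertex (ULift.{u} Bool) (fun _ => true)) ⟶ .core)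

/-- `𝒳_1 →(log) 𝒳_0 →(id_0) □`. [cite: MochizukiAbsTopIII2015, Cor 5.5 p. 129] -/
def logPrefix : Path (DVertex.row1 (0 + 1) : DVertex (ULift.{u} Bool) (fun _ => true)) .core :=
  (Path.nil.cons (DEdge.log 0 : (DVertex.row1 (0 + 1) : DVertex (ULift.{u} Bool) (fun _ => true)) ⟶ .row1 0)).cons
    (DEdge.toCore 0 : (DVertex.row1 0 : DVertex (ULift.{u} Bool) (fun _ => true)) ⟶ .core)

/-- the `id`-first path `𝒳_1 → □ →(λ⊞_{v,ν}) ⋯ → ℰ•`. [cite: MochizukiAbsTopIII2015, Cor 5.5 (v) p. 133] -/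
def idFirst (v : ULift.{u} Bool) (ν : LogVertex true) (hν : ν.isPostLog = false) :
    Path (DVertex.row1 (0 + 1) : DVertex (ULift.{u} Bool) (fun _ => true)) .e5 :=
  idPrefix.comp (fromCore v ν hν)

/-- the `log`-first path `𝒳_1 → 𝒳_0 → □ →(λ⊞_{v,sl}) 𝒩⊞_v → 𝒩_v → ℰ•`.
[cite: MochizukiAbsTopIII2015, Cor 5.5 (v) p. 133] -/
def logFirst (v : ULift.{u} Bool) : Path (DVertex.row1 (0 + 1) : DVertex (ULift.{u} Bool) (fun _ => true)) .e5 :=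
  logPrefix.comp (fromCore v (LogVertex.spaceLink true) (spaceLink_isPostLog true))

/-- `logFirst` is the post-log path of `LogFrobeniusShiftActionPostLogPair` at `⋎ = 0`, followed by the tail. [folklore] -/
private theorem logFirst_eq (v : ULift.{u} Bool) : logFirst v =
    ((Path.nil.cons (DEdge.log 0 : (DVertex.row1 (0 + 1) : DVertex (ULift.{u} Bool) (fun _ => true)) ⟶ .row1 0)).comp
      ((Path.nil.cons (DEdge.toCore 0 : (DVertex.row1 0 : DVertex (ULift.{u} Bool) (fun _ => true)) ⟶ .core)).comp
        (Path.nil.cons (DEdge.lam v (LogVertex.spaceLink true) (spaceLink_isPostLog true) :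
          (DVertex.core : DVertex (ULift.{u} Bool) (fun _ => true)) ⟶ .nplus v)))).comp (tail v) := rfl

/-- `idFirst` is the `id`-first path of the observable pairs, followed by the tail. [folklore] -/
private theorem idFirst_eq (v : ULift.{u} Bool) (ν : LogVertex true) (hν : ν.isPostLog = false) : idFirst v ν hν =
    ((Path.nil.cons (DEdge.toCore (0 + 1) : (DVertex.row1 (0 + 1) : DVertex (ULift.{u} Bool) (fun _ => true)) ⟶ .core)).comp
      (Path.nil.cons (DEdge.lam v ν hν : (DVertex.core : DVertex (ULift.{u} Bool) (fun _ => true)) ⟶ .nplus v))).comp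
        (tail v) := rfl

/-- The archimedean vertices `k~` (pre-log), `k^×` are pre-log; the post-log vertex is post-log (Def 5.4 (v)).
[cite: MochizukiAbsTopIII2015, Def 5.4 (v) p. 127] -/
theorem arch_isPostLog : LogVertex.isPostLog (b := true) ArchVertex.pre = false ∧
    LogVertex.isPostLog (b := true) ArchVertex.mult = false ∧ (LogVertex.postLog true).isPostLog = true := by
  refine ⟨?_, ?_, ?_⟩ <;> decide

/-! ## The twisted diagonal setting -/

variable (C : Type (u + 1)) [Category.{u} C] [Preadditive C]

/-- the twist: `−id` for the post-log vertex at the place `true`, `+id` otherwise.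
[cite: MochizukiAbsTopIII2015, Def 5.4 (vii) p. 128] -/
def twist (v : ULift.{u} Bool) (b : Bool) : ((𝟭 C : C ⥤ C) ⟶ 𝟭 C) := cond (v.down && b) (-(𝟙 (𝟭 C))) (𝟙 (𝟭 C))

/-- components of the twist. [folklore] -/
private theorem twist_app (v : ULift.{u} Bool) (b : Bool) (X : C) : (twist C v b).app X = cond (v.down && b) (-(𝟙 X)) (𝟙 X) := by
  unfold twist
  cases (v.down && b)
  · rfl
  · exact NatTrans.app_neg X _

/-- the twist is invertible. [folklore] -/
private theorem isIso_twist (v : ULift.{u} Bool) (b : Bool) : IsIso (twist C v b) := by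
  unfold twist
  cases (v.down && b)
  · exact IsIso.id _
  · show IsIso (-(𝟙 (𝟭 C)))
    exact ⟨⟨-(𝟙 (𝟭 C)), by rw [Preadditive.neg_comp_neg, Category.id_comp],
      by rw [Preadditive.neg_comp_neg, Category.id_comp]⟩⟩

omit [Preadditive C] in
/-- `Λ_ν` for the identity log-Frobenius functor is the identity (private copy of abc-iut-w5-d097's
`frobeniusTwist_id_comp_id_eq`, to keep the imports light). [cite: MochizukiAbsTopIII2015, Def 5.4 (vii) p. 128] -/
private theorem frobeniusTwist_id_comp_id (b : Bool) : frobeniusTwist (𝟭 C) b ⋙ 𝟭 C = 𝟭 C := by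
  cases b <;> rfl

/-- **The twisted diagonal setting** over the index set `ULift Bool` with both places archimedean: all rows `C`, all structure
functors `𝟭 C`, all 2-cells identities, `ι⊞_{v,ε} :=` the twist (`−id` on the post-log arrow at `true`, `+id` otherwise).
DEGENERATE calibration device. [cite: MochizukiAbsTopIII2015, Def 5.4 (ii) p. 125] -/
def setting : LogFrobeniusSetting (ULift.{u} Bool) (fun _ => true) where
  X := C
  E := C
  proj := 𝟭 C
  log := 𝟭 C
  logIsoId := Iso.refl _
  logOver := Iso.refl _
  Nplus := fun _ => C
  N := fun _ => C
  forget := fun _ => 𝟭 C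
  toE := fun _ => 𝟭 C
  lam := fun _ _ => 𝟭 C
  lamOver := fun _ _ => Iso.refl _
  lam_spaceLink_eq_postLog := fun _ => rfl
  iota := fun v ν₁ _ _ => eqToHom (frobeniusTwist_id_comp_id C ν₁.isPostLog) ≫ twist C v ν₁.isPostLog
  An := C
  κAn := CategoryTheory.Equivalence.refl
  φAn := 𝟭 C
  φAn_isEquivalence := inferInstance
  ηAn := Iso.refl _
  κAn₂ := CategoryTheory.Equivalence.refl
  Emono := C
  monoAn := 𝟭 C
  NmonoPlus := fun _ => C
  Nmono := fun _ => C
  forgetMono := fun _ => 𝟭 C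
  toEmono := fun _ => 𝟭 C
  monoNplus := fun _ => 𝟭 C
  monoN := fun _ => 𝟭 C
  monoHomotopy := fun _ => Iso.refl _
  AnMono := C
  κAnMono := CategoryTheory.Equivalence.refl
  ψAnMono := fun _ _ => 𝟭 C

/-- the components of `ι⊞_{v,ε}` in the twisted setting. [cite: MochizukiAbsTopIII2015, Def 5.4 (vii) p. 128] -/
theorem iota_app_heq (v : ULift.{u} Bool) {ν₁ ν₂ : LogVertex true} (ε : LogEdge true ν₁ ν₂) (X : C) :
    HEq (((setting C).iota v ε).app X) (cond (v.down && ν₁.isPostLog) (-(𝟙 X)) (𝟙 X)) := by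
  change HEq ((eqToHom (frobeniusTwist_id_comp_id C ν₁.isPostLog) ≫ twist C v ν₁.isPostLog).app X) _
  rw [NatTrans.comp_app, eqToHom_app, twist_app]
  exact eqToHom_comp_heq _ _

/-- **Every `ι⊞_{v,ε}` of the twisted setting is an isomorphism.** [cite: MochizukiAbsTopIII2015, Def 5.4 (vii) p. 128] -/
theorem isIso_iota (v : ULift.{u} Bool) {ν₁ ν₂ : LogVertex true} (ε : LogEdge true ν₁ ν₂) :
    IsIso ((setting C).iota v ε) := by
  change IsIso (eqToHom (frobeniusTwist_id_comp_id C ν₁.isPostLog) ≫ twist C v ν₁.isPostLog)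
  haveI := isIso_twist C v ν₁.isPostLog
  exact IsIso.comp_isIso

/-- every category of the setting is `C`. [folklore] -/
private theorem obj_eq (a : DVertex (ULift.{u} Bool) (fun _ => true)) : (setting C).diagram.obj a = C := by
  cases a <;> rfl

/-- … with its given category structure. [folklore] -/
private theorem cat_heq (a : DVertex (ULift.{u} Bool) (fun _ => true)) :
    HEq ((setting C).diagram.cat a) (inferInstance : Category C) := by
  cases a <;> rfl

/-- every arrow functor of the setting is the identity on objects. [folklore] -/
private theorem map_obj_heq {a b : DVertex (ULift.{u} Bool) (fun _ => true)} (e : a ⟶ b) (y : (setting C).diagram.obj a) :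
    HEq (((setting C).diagram.map e).obj y) y := by
  cases e <;> exact HEq.rfl

/-- … and on morphisms. [folklore] -/
private theorem map_map_heq {a b : DVertex (ULift.{u} Bool) (fun _ => true)} (e : a ⟶ b) {y z : (setting C).diagram.obj a}
    (g : y ⟶ z) : HEq (((setting C).diagram.map e).map g) g := by
  cases e <;> exact HEq.rfl

/-- every path functor of the setting is the identity on objects. [folklore] -/
private theorem pathFunctor_obj_heq {a b : DVertex (ULift.{u} Bool) (fun _ => true)} (p : Path a b) (y : (setting C).diagram.obj a) :
    HEq (((setting C).diagram.pathFunctor p).obj y) y := by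
  induction p with
  | nil => rw [DiagramOfCategories.pathFunctor_nil]; exact HEq.rfl
  | cons p e ih =>
    rw [DiagramOfCategories.pathFunctor_cons]
    exact (map_obj_heq C e _).trans ih

/-- … and on morphisms. [folklore] -/
private theorem pathFunctor_map_heq {a b : DVertex (ULift.{u} Bool) (fun _ => true)} (p : Path a b)
    {y z : (setting C).diagram.obj a} (g : y ⟶ z) : HEq (((setting C).diagram.pathFunctor p).map g) g := by
  induction p with
  | nil => rw [DiagramOfCategories.pathFunctor_nil]; exact HEq.rfl
  | cons p e ih =>
    rw [DiagramOfCategories.pathFunctor_cons]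
    exact (map_map_heq C e _).trans ih

/-! ## No family realises the cores and observables at the twisted setting -/

/-- **CROSS-PLACE OBSTRUCTION.**  If `−𝟙_{x₀} ≠ 𝟙_{x₀}` for some object `x₀` of `C`, no family of homotopies on the `D•⊢`
of the twisted setting realises the cores of Cor 5.5 (i) and the observables of (iii) (`RealisesCor55Families`, F-0159): the
homotopy which the core `ℰ•` assigns (Def 3.5 (iii)) to the pair (`log`-first, `id`-first) of `λ_sl`-paths `𝒳_1 → ℰ•` at the
place `true` is `−𝟙_{x₀}` when composed along that place (post-log `ι`, then `ι_shell`, `ι_link` — Def 3.5 (ii), second axiom)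
and `𝟙_{x₀}` when composed through the place `false` (the `□`-level core isomorphism between the `λ_sl`-paths of the two places,
the untwisted chain there, and the inverse isomorphism). [cite: MochizukiAbsTopIII2015, Cor 5.5 (v) pp. 131–133] -/
theorem not_realisesCor55Families (x₀ : C) (hx₀ : (-(𝟙 x₀) : x₀ ⟶ x₀) ≠ 𝟙 x₀) (K : (setting C).diagram.HomotopyFamily) :
    ¬ (setting C).RealisesCor55Families K := by
  intro hK
  obtain ⟨hpre, hmult, hpl⟩ := arch_isPostLog
  have hsl : LogVertex.isPostLog (b := true) (LogVertex.spaceLink true) = false := spaceLink_isPostLog true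
  -- every pair of paths `𝒳_1 → ℰ•`, `□ → ℰ•` is a boundary pair of `K` (the core `ℰ•` of Cor 5.5 (i))
  have hall : ∀ {a : DVertex (ULift.{u} Bool) (fun _ => true)} (_ : DVertex.InFirstRows 4 a)
      (p q : Path a (DVertex.e5 : DVertex (ULift.{u} Bool) (fun _ => true))), K.E p q := fun ha p q =>
    (setting C).E_of_isCoreOnIn hK.1 (by simp [DVertex.InFirstRows, DVertex.row]) (fun e h => DVertex.inFirstRows_of_hom e h)
      (fun e => by cases e; exact ⟨trivial, Nat.le_of_ble_eq_true rfl⟩) ha p q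
  have h1 : DVertex.InFirstRows 4 (DVertex.row1 (0 + 1) : DVertex (ULift.{u} Bool) (fun _ => true)) :=
    ⟨trivial, Nat.le_of_ble_eq_true rfl⟩
  have hc : DVertex.InFirstRows 4 (DVertex.core : DVertex (ULift.{u} Bool) (fun _ => true)) :=
    ⟨trivial, Nat.le_of_ble_eq_true rfl⟩
  -- bookkeeping: the category at `ℰ•` is `C`, path functors are the identity on `x₀`
  have hE : (setting C).diagram.obj DVertex.e5 = C := obj_eq C _
  have hiE := cat_heq C DVertex.e5
  have hO : ∀ (p : Path (DVertex.row1 (0 + 1) : DVertex (ULift.{u} Bool) (fun _ => true)) .e5),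
      HEq (((setting C).diagram.pathFunctor p).obj x₀) x₀ := fun p => pathFunctor_obj_heq C p x₀
  -- (1) the post-log pair at `v`, whiskered by the tail: homotopy = the twist at `v`
  have pin_post : ∀ v : ULift.{u} Bool,
      HEq ((K.η (hall h1 (logFirst v) (idFirst v ArchVertex.pre hpre))).app x₀) (cond v.down (-(𝟙 x₀)) (𝟙 x₀)) := by
    intro v
    obtain ⟨k, hk⟩ := (setting C).exists_η_postLogPair_eq_iota (K := K) v (hK.2.2.2 v)
      (ν₂ := (ArchVertex.pre : LogVertex true))
      (ArchEdge.postLogId : LogEdge true (LogVertex.postLog true) ArchVertex.pre) hpre 0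
    have h' := K.isSaturated.precomp (K.isSaturated.postcomp k (tail v)) Path.nil
    refine (K.η_app_heq_of_heq rfl rfl (heq_of_eq ((logFirst_eq v).trans (Path.nil_comp _).symm))
      (heq_of_eq ((idFirst_eq v _ hpre).trans (Path.nil_comp _).symm)) _ h' (HEq.refl _)).trans ?_
    refine (K.η_app_heq_map_of_whisker k Path.nil (tail v) h' x₀).trans ?_
    refine (pathFunctor_map_heq C (tail v) _).trans ?_
    obtain ⟨a₁, a₂, E⟩ :=
      hk (((setting C).diagram.pathFunctor (Path.nil : Path (DVertex.row1 (0 + 1) : DVertex (ULift.{u} Bool) _) _)).obj x₀)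
    rw [E]
    refine (eqToHom_comp_comp_eqToHom_heq_of_heq a₁ a₂ _ HEq.rfl).trans ?_
    refine (iota_app_heq C v _ _).trans ?_
    rw [hpl, Bool.and_true, DiagramOfCategories.pathFunctor_nil]
    rfl
  -- (2) a pre-log pair `(λ⊞_ν, λ⊞_ν')` of `S_log⊞_v`, whiskered by `id_1` and the tail: homotopy `+id`
  have pin_pre : ∀ (v : ULift.{u} Bool) {ν ν' : LogVertex true} (ε : LogEdge true ν ν') (hν : ν.isPostLog = false)
      (hν' : ν'.isPostLog = false), HEq ((K.η (hall h1 (idFirst v ν hν) (idFirst v ν' hν'))).app x₀) (𝟙 x₀) := by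
    intro v ν ν' ε hν hν'
    obtain ⟨k, hk⟩ := (setting C).exists_η_obsPair_eq_iota (K := K) v (hK.2.2.2 v) ε hν hν'
    have h' := K.isSaturated.precomp (K.isSaturated.postcomp k (tail v)) idPrefix
    refine (K.η_app_heq_of_heq rfl rfl (heq_of_eq (idFirst_eq v ν hν)) (heq_of_eq (idFirst_eq v ν' hν')) _ h'
      (HEq.refl _)).trans ?_
    refine (K.η_app_heq_map_of_whisker k idPrefix (tail v) h' x₀).trans ?_
    refine (pathFunctor_map_heq C (tail v) _).trans ?_
    obtain ⟨a₁, a₂, E⟩ := hk (((setting C).diagram.pathFunctor idPrefix).obj x₀)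
    rw [E]
    refine (eqToHom_comp_comp_eqToHom_heq_of_heq a₁ a₂ _ HEq.rfl).trans ?_
    refine (iota_app_heq C v ε _).trans ?_
    rw [hν, Bool.and_false]
    exact CategoryTheory.id_heq_of_heq_obj rfl HEq.rfl (pathFunctor_obj_heq C idPrefix x₀)
  -- (3) the `□`-level core isomorphism `α` between the `λ_sl`-paths of the two places, and its inverse
  have hD₁₂ := hall hc (fromCore ⟨true⟩ _ hsl) (fromCore ⟨false⟩ _ hsl)
  have hD₂₁ := hall hc (fromCore ⟨false⟩ _ hsl) (fromCore ⟨true⟩ _ hsl)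
  have hY₂ : ((setting C).diagram.pathFunctor logPrefix).obj x₀ = x₀ := eq_of_heq (pathFunctor_obj_heq C logPrefix x₀)
  have hY₁ : ((setting C).diagram.pathFunctor idPrefix).obj x₀ = x₀ := eq_of_heq (pathFunctor_obj_heq C idPrefix x₀)
  have pin_A : HEq ((K.η (hall h1 (logFirst ⟨true⟩) (logFirst ⟨false⟩))).app x₀) ((K.η hD₁₂).app x₀) := by
    refine (K.η_app_heq_of_precomp hD₁₂ logPrefix (hall h1 (logFirst ⟨true⟩) (logFirst ⟨false⟩)) x₀).trans ?_
    rw [hY₂]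
  have pin_C : HEq ((K.η (hall h1 (idFirst ⟨false⟩ _ hsl) (idFirst ⟨true⟩ _ hsl))).app x₀) ((K.η hD₂₁).app x₀) := by
    refine (K.η_app_heq_of_precomp hD₂₁ idPrefix (hall h1 (idFirst ⟨false⟩ _ hsl) (idFirst ⟨true⟩ _ hsl)) x₀).trans ?_
    rw [hY₁]
  -- `α`, `α⁻¹` as endomorphisms of `x₀`
  have hP₁ : ((setting C).diagram.pathFunctor (fromCore ⟨true⟩ _ hsl)).obj x₀ = x₀ :=
    eq_of_heq (pathFunctor_obj_heq C (fromCore ⟨true⟩ _ hsl) x₀)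
  have hP₂ : ((setting C).diagram.pathFunctor (fromCore ⟨false⟩ _ hsl)).obj x₀ = x₀ :=
    eq_of_heq (pathFunctor_obj_heq C (fromCore ⟨false⟩ _ hsl) x₀)
  let α : x₀ ⟶ x₀ := eqToHom hP₁.symm ≫ (K.η hD₁₂).app x₀ ≫ eqToHom hP₂
  let β : x₀ ⟶ x₀ := eqToHom hP₂.symm ≫ (K.η hD₂₁).app x₀ ≫ eqToHom hP₁
  have hα : HEq ((K.η hD₁₂).app x₀) α := (eqToHom_comp_comp_eqToHom_heq_of_heq hP₁.symm hP₂ _ HEq.rfl).symm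
  have hβ : HEq ((K.η hD₂₁).app x₀) β := (eqToHom_comp_comp_eqToHom_heq_of_heq hP₂.symm hP₁ _ HEq.rfl).symm
  have hαβ : α ≫ β = 𝟙 x₀ := by
    have h := NatTrans.congr_app (η_comp_η_eq_id K hD₁₂ hD₂₁) x₀
    rw [NatTrans.comp_app, NatTrans.id_app] at h
    have e : HEq (α ≫ β) ((K.η hD₁₂).app x₀ ≫ (K.η hD₂₁).app x₀) :=
      CategoryTheory.comp_heq_of_heq hE.symm hiE.symm (heq_of_eq hP₁.symm) (heq_of_eq hP₂.symm) (heq_of_eq hP₁.symm)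
        hα.symm hβ.symm
    rw [h] at e
    exact eq_of_heq (e.trans (CategoryTheory.id_heq_of_heq_obj hE hiE (heq_of_eq hP₁)))
  -- composites of homotopies (Def 3.5 (ii), second axiom), componentwise
  have tr : ∀ {p q r : Path (DVertex.row1 (0 + 1) : DVertex (ULift.{u} Bool) (fun _ => true)) .e5} (h₁ : K.E p q)
      (h₂ : K.E q r), (K.η (hall h1 p r)).app x₀ = (K.η h₁).app x₀ ≫ (K.η h₂).app x₀ := by
    intro p q r h₁ h₂
    rw [show K.η (hall h1 p r) = K.η (K.isSaturated.trans h₁ h₂) from rfl, K.η_trans]; rfl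
  -- the ONE homotopy between the `log`-first and the `id`-first `λ_sl`-path at the place `true`, computed two ways
  have hAC := hall h1 (logFirst ⟨true⟩) (idFirst ⟨true⟩ _ hsl)
  -- (a) along the place `true`: `(−1) · 1 · 1`
  have way₁ : HEq ((K.η hAC).app x₀) ((-(𝟙 x₀)) ≫ 𝟙 x₀ ≫ 𝟙 x₀) := by
    rw [tr (hall h1 (logFirst ⟨true⟩) (idFirst ⟨true⟩ ArchVertex.pre hpre)) (hall h1 _ _),
      tr (hall h1 (idFirst ⟨true⟩ ArchVertex.pre hpre) (idFirst ⟨true⟩ ArchVertex.mult hmult)) (hall h1 _ _)]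
    exact CategoryTheory.comp_heq_of_heq hE hiE (hO _) (hO _) (hO _) (pin_post ⟨true⟩)
      (CategoryTheory.comp_heq_of_heq hE hiE (hO _) (hO _) (hO _)
        (pin_pre ⟨true⟩ (ArchEdge.shell : LogEdge true ArchVertex.pre ArchVertex.mult) hpre hmult)
        (pin_pre ⟨true⟩ (ArchEdge.multToSpaceLink : LogEdge true ArchVertex.mult ArchVertex.spaceLink) hmult hsl))
  -- (b) through the place `false`: `α · (1 · 1 · 1) · α⁻¹`
  have way₂ : HEq ((K.η hAC).app x₀) (α ≫ ((𝟙 x₀ ≫ 𝟙 x₀ ≫ 𝟙 x₀) ≫ β)) := by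
    rw [tr (hall h1 (logFirst ⟨true⟩) (logFirst ⟨false⟩)) (hall h1 _ _),
      tr (hall h1 (logFirst ⟨false⟩) (idFirst ⟨false⟩ _ hsl)) (hall h1 _ _),
      tr (hall h1 (logFirst ⟨false⟩) (idFirst ⟨false⟩ ArchVertex.pre hpre)) (hall h1 _ (idFirst ⟨false⟩ _ hsl)),
      tr (hall h1 (idFirst ⟨false⟩ ArchVertex.pre hpre) (idFirst ⟨false⟩ ArchVertex.mult hmult)) (hall h1 _ _)]
    refine CategoryTheory.comp_heq_of_heq hE hiE (hO _) (hO _) (hO _) (pin_A.trans hα)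
      (CategoryTheory.comp_heq_of_heq hE hiE (hO _) (hO _) (hO _) ?_ (pin_C.trans hβ))
    exact CategoryTheory.comp_heq_of_heq hE hiE (hO _) (hO _) (hO _) (pin_post ⟨false⟩)
      (CategoryTheory.comp_heq_of_heq hE hiE (hO _) (hO _) (hO _)
        (pin_pre ⟨false⟩ (ArchEdge.shell : LogEdge true ArchVertex.pre ArchVertex.mult) hpre hmult)
        (pin_pre ⟨false⟩ (ArchEdge.multToSpaceLink : LogEdge true ArchVertex.mult ArchVertex.spaceLink) hmult hsl))
  have key : ((-(𝟙 x₀)) ≫ 𝟙 x₀ ≫ 𝟙 x₀ : x₀ ⟶ x₀) = α ≫ ((𝟙 x₀ ≫ 𝟙 x₀ ≫ 𝟙 x₀) ≫ β) :=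
    eq_of_heq (way₁.symm.trans way₂)
  simp only [Category.comp_id, Category.id_comp] at key
  exact hx₀ (key.trans hαβ)

/-! ## The per-place necessary conditions are not sufficient -/

/-- **Cross-place obstruction, existence form.**  Over the index set of two archimedean places there is a setting — the
twisted diagonal setting on abelian groups (`−1 ≠ 1` in `ℤ`) — ALL of whose `ι⊞_{v,ε}` are ISOMORPHISMS (so every `ι⊞` is
invertible over `ℰ•`, the per-place condition of `isIso_toE_forget_iota_of_realisesCor55Families` holds, and the archimedean
graphs have no `ι⊞`-squares to commute) at which NO family realises Cor 5.5 (i)/(iii) (F-0159); hence `Cor55ShiftAction`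
(F-0157, by `cor55ShiftAction_iff_exists_realisesCor55Families`) and `Cor55Rigidity` (F-0156) fail.  DEGENERATE calibration
witness; a statement about the typed interface. [cite: MochizukiAbsTopIII2015, Cor 5.5 (v) pp. 131–133] -/
theorem exists_forall_not_realises_of_isIso_iota :
    ∃ L : LogFrobeniusSetting (ULift.{u} Bool) (fun _ => true),
      (∀ (v : ULift.{u} Bool) {ν₁ ν₂ : LogVertex true} (ε : LogEdge true ν₁ ν₂), IsIso (L.iota v ε)) ∧
      (∀ K : L.diagram.HomotopyFamily, ¬ L.RealisesCor55Families K) ∧ ¬ L.Cor55ShiftAction ∧ ¬ L.Cor55Rigidity := by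
  have hx₀ : (-(𝟙 (AddCommGrpCat.of (ULift.{u} ℤ))) : _ ⟶ _) ≠ 𝟙 _ := by
    intro h
    have h1 := congrArg (fun f : AddCommGrpCat.of (ULift.{u} ℤ) ⟶ AddCommGrpCat.of (ULift.{u} ℤ) =>
      (f.hom (ULift.up 1)).down) h
    simp at h1
  refine ⟨setting AddCommGrpCat.{u}, fun v _ _ ε => isIso_iota _ v ε, not_realisesCor55Families _ _ hx₀, ?_, ?_⟩
  · exact fun h => ((setting AddCommGrpCat.{u}).cor55ShiftAction_iff_exists_realisesCor55Families.mp h).elim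
      fun K hK => not_realisesCor55Families _ _ hx₀ K hK
  · exact fun h => ((setting AddCommGrpCat.{u}).cor55ShiftAction_iff_exists_realisesCor55Families.mp h.2).elim
      fun K hK => not_realisesCor55Families _ _ hx₀ K hK

end CrossPlaceToy

end LogFrobeniusSetting

end Literature.AnabelianGeometry.AbsoluteAnabelian
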